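import Summits.HodgeConjecture.HodgeConjecture.Theorems.F0P6aKillEngine
import Summits.HodgeConjecture.HodgeConjecture.Theorems.F0P6aRoofKernelCount
import Literature.AlgebraicGeometry.GroupSchemes.AdmissibleIdealClosureSubschemeImage
import Literature.AlgebraicGeometry.GroupSchemes.SubPinCompCoverClosedImmersion
import Literature.AlgebraicGeometry.AbelianSchemes.RoofLegsSpecialFibreKernelRowsImage
import Literature.AlgebraicGeometry.GroupSchemes.EtaleSchemeHomThroughClosedSubscheme
import Literature.AlgebraicGeometry.AbelianSchemes.RoofImageLineCount
import Literature.AlgebraicGeometry.AbelianSchemes.SerreTranslateScalarReturnMap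
import Literature.AlgebraicGeometry.AbelianSchemes.IdealTorsionSubgroupScheme
import Literature.AlgebraicGeometry.AbelianSchemes.SerreTensorIdealTranslationKernel
import HarnessLib
import HarnessLib.Audit.LibrarySuggestionsDenyListCruxes

/-!
# `F0P6aImgSectionKill` — ★ RE-HOME of `Lines/F0_P6a_ImgSection.lean` (tree sha16 bfb84779d70f88f8, 943 l.), PART 1 of 4 — tree lines :1–:280
K6 verbatim twin (L2 column; pen LA2-plan (g5) PLAN v1.3 Δ5 cut set of record [281, 589, 890]; hand LA2-p02 (g5), `mkparts2.py` cand.v2.LA2-p02g5): the code below this header is the tree bytes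
of the stated range untouched, namespace KEPT (every fully-qualified name unchanged); later parts re-open the scopes live at their first line with their `open` ∕ `variable` ∕
`universe` ∕ section `set_option` lines replayed verbatim (certified by one-file split rehearsal, LA2-p02 TABLE v2∕v3).  Header canonical per LEAD «M-142a» (A): bare imports only.

## Import provenance — ★ twin stems (LAST part, plain stem) replacing `Cruxes.HLiu418.Lines` imports: `F0P6aKillEngine` ← `Lines.F0_P6a_KillEngine`;
  `F0P6aRoofKernelCount` ← `Lines.F0_P6a_RoofKernelCount`.
`import HarnessLib.Audit.LibrarySuggestionsDenyListCruxes` kept on this ROOT part per LEAD «M-142d» «P-κ» (parts 2… inherit it); every other import = the tree list made bare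
(the trailing provenance comments of 8 import lines stay in the tree file `Lines/F0_P6a_ImgSection.lean` ll. 1–11).
Original module docstring: reproduced verbatim below this header block (part of the tree bytes :1–:280).  HC_CM is proved only modulo the 7 printed citations (2 remaining: hLiu418 = stmt-HodgeConjecture-24832, h413 = stmt-HodgeConjecture-24833) until rung 0 closes; a re-home is count-neutral.
-/

/-!
# § IMG LEAFLET `Cruxes/HLiu418/Lines/F0_P6a_ImgSection.lean` — THE (IMG) ROW OF `stub_RHO1` (line L2; LA2-plan (g2) ruling 2026-09-02T11:17:16Z (4): OWN LEAFLET,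
# not a PART C block) — ED. 1 (file of record: (F1) discharged on LS ED. 3)

Namespace `Summit.HodgeConjecture.HodgeConjecture.Cruxes.HLiu418.F0P6aLineSpecialisation`; imports the SERVED leaflets (KE ⊇ LS, RKC) + ★ only; 0 sorry; every
declaration ≤ 400 000 heartbeats; no instance ∕ notation ∕ def (the two abbreviations `satOf`∕`closureInclOf` it uses are the served KILL engine's).  Registered
nowhere (a leaflet: 0 importers until `Lines/F0_P6a_StubRHO1.lean` imports it, ruling (3)).  Authors: A-p06 (g36) (§T, §1–§2, HEAD `himg_spGeoOf_of_imgLine` =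
`ImgRowDown.v2` 1c1489be BY COPY minus its §0) and A-p06 (g37) ((U1′)(U1)(U1″)(T1-LS) = `ImgRowUp.v4`, the ASSEMBLED HEADS `himg_spGeoOf_of_roofRows[_of_sigma]`, the
row packagings `row_IMG[_of_sigma]`).  HC_CM is proved only modulo the 7 printed citations (2 remaining: hLiu418 = stmt-HodgeConjecture-24832, h413 =
stmt-HodgeConjecture-24833) until rung 0 closes; count-neutral.

WHAT IT PROVES.  The (IMG) row of the (ρ1𝒞) body `exists_quotLegReduction_of_legs` — «for every `T`-point `t` of the dock `G₀(x̄)` there is `s : T → V(H″)`,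
`H″ := spGeoOf I 𝔡 y″ Lb`, with `s ≫ V(H″) ↪ G₀(x̄″) ↪ A_{x̄″} —c̄→ = t ≫ G₀(x̄) ↪ A_{x̄} —ψ→`» — from the (ρ1𝒞) consumer's OWN tokens only: the roof legs `q c` with rows
(r2) `Ker c(Ω̄) = A_{y″}[𝔭_w]`, `c` onto, (r4) common intertwiners; the Serre letters `(E′, P, Q)` of `𝔭_w`; § J's image line `Lb` with its membership law (B-p08
`imgLine_quotΩ_quotΩ_eq_translΩ_assembled`, `mem_imgLineOfRoof_iff` = `Iff.rfl`); the (IMG-gen) row of ITS reduced leg `ψ` ((b″)∕★ p850875 last conjunct, closed-immersion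
instance at the MODEL cover `ψ_P ×_𝓨 ỹ″`).  ROAD: UPSTAIRS the factorisation of `layerΩ I y ↪ A_y —q→ B` through `V(eL Lb) ↪ layerΩ I y″ ↪ A_{y″} —c→ B` is a MORPHISM
because the generic layer is finite étale over `Ω̄ = Ω̄^alg` (★ p851153∕p851176) and every layer point has a partner in `Lb` (the torsion LIFT through `c`, ★ p850779);
it extends to the flat closure `V((eL Lb)^sat) ↪ layerR I y″` (★ p850899 (IMG-in)), whose composite with the model cover leg is a CLOSED IMMERSION (★ p850881 + the scalar
return map ★ p851208: `a ∈ 𝔭_w`, `a + b = 1`, `b ∈ 𝔭_{c•w}`); the (IMG-gen) row carries the factorisation to the special fibre; ★ p850899 (IMG-out) lands it in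
`V(spI (eL Lb))`, and the dock transport `εOf` turns `spI` into `spGeoOf` (LS §1d).
-/

set_option autoImplicit false
set_option linter.dupNamespace false

noncomputable section

namespace Summit.HodgeConjecture.HodgeConjecture.Cruxes.HLiu418.F0P6aLineSpecialisation

open CategoryTheory CategoryTheory.Limits NumberField IsDedekindDomain MulAction AlgebraicGeometry
open scoped Matrix Polynomial Pointwise MonoidalCategory
open Literature.NumberTheory.GaloisRepresentations
open Literature.NumberTheory.Automorphic Literature.NumberTheory.Automorphic.UnitaryGroup
open Literature.AlgebraicGeometry.ShimuraVarieties.UnitaryCanonicalModel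
open Literature.NumberTheory.Automorphic.Liu2021.AppendixC
open Literature.AlgebraicGeometry.Motives (AlgPoints IntegralModel SchemeOver thickening thickeningGalAction thickeningLift specOver extendPoint
  specValuationSubring specFractionFieldι specRingHomι)
open Literature.NumberTheory.DiophantineGeometry (geomResidueField specialFibreFunctor specResidueField geomClosedPointIsoSpecResidueField
  geomResidueFieldEquiv toClosureValuationSubring)
open Literature.AlgebraicGeometry.RelativeSpec (ActionOver)
open Literature.NumberTheory.EllipticCurves (genericFibre specGenericPoint)
open Literature.AlgebraicGeometry.AbelianSchemes Literature.AlgebraicGeometry.AbelianSchemes.AbelianSchemeOver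
open Literature.AlgebraicGeometry.GroupSchemes.AffineGroupScheme (Alg)
open Summit.HodgeConjecture.HodgeConjecture.Cruxes.HLiu418.F0P6aModuliDatumDefs
open Summit.HodgeConjecture.HodgeConjecture.Cruxes.HLiu418.F0P6aRGDAssembly
open Summit.HodgeConjecture.HodgeConjecture.Cruxes.HLiu418.F0P6aDatumOfInputs

/-! ### §T (generic, stated first) Base-point transport of a FACTORISATION printed through the three-piece isomorphisms at two base points (KILL engine §3 shape) -/

section Transport

universe u

open scoped MonObj CategoryTheory.Obj

/-- **BASE-POINT TRANSPORT OF A SPECIAL FACTORISATION.**  `𝒜 → T` an abelian scheme, `j : U → T`, `x̄ x̄₂ : Spec κ → U`, `x_R x_R₂ : V → T`, two EQUAL base points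
`s₁ = s₂ : Spec κ → V` with `x̄ ≫ j = sᵢ ≫ x_R`, `x̄₂ ≫ j = sᵢ ≫ x_R₂`; `incl : 𝒦 → 𝒜 ×_T V` along `x_R`, `ζ : 𝒵 → 𝒜 ×_T V` along `x_R₂`.  A factorisation of
`incl_{s₁} ≫ e⁻¹ ≫ q̄` through `ζ_{s₁} ≫ e⁻¹ ≫ c̄` (three-piece isomorphisms of ★ (d5)) is one at `s₂` (the middle piece `fibreCongrPtIso` is `eqToIso`: `subst`).  Use:
`s₁ = c⁻¹ ≫ Spec (residue R)` (★ row currency), `s₂ = sκ w` (the leaflet's), equal by `specMap_toGeomκ_eq`. [cite: GortzWedhorn2020, Section (4.7) (p. 135) and Prop. 4.16]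
[cite: SerreTate1968, §1 Lemma 2] -/
theorem exists_comp_threePiece_inv_of_eq₂ {T Us Vr : Scheme.{u}} {κ : Type u} [Field κ]
    (j : Us ⟶ T) (xbar xbar₂ : Spec (.of κ) ⟶ Us) (xR xR₂ : Vr ⟶ T) (𝒜 : AbelianSchemeOver T)
    {s₁ s₂ : Spec (.of κ) ⟶ Vr} (h : s₁ = s₂) (hpt₁ : xbar ≫ j = s₁ ≫ xR) (hpt₂ : xbar ≫ j = s₂ ≫ xR)
    (hpt₁' : xbar₂ ≫ j = s₁ ≫ xR₂) (hpt₂' : xbar₂ ≫ j = s₂ ≫ xR₂)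
    {𝒦 𝒵 : Over Vr} (incl : 𝒦 ⟶ (𝒜.baseChange xR).X) (ζ : 𝒵 ⟶ (𝒜.baseChange xR₂).X) {M : Over (Spec (.of κ))}
    (qbar : ((𝒜.baseChange j).baseChange xbar).X ⟶ M) (cbar : ((𝒜.baseChange j).baseChange xbar₂).X ⟶ M)
    (h₁ : ∃ m : (Over.pullback s₁).obj 𝒦 ⟶ (Over.pullback s₁).obj 𝒵,
      m ≫ (((Over.pullback s₁).map ζ ≫
          (𝒜.fibreBaseChangeIso j xbar₂ ≪≫ 𝒜.fibreCongrPtIso hpt₁' ≪≫ (𝒜.fibreBaseChangeIso xR₂ s₁).symm).inv.hom.hom.hom) ≫ cbar) =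
        ((Over.pullback s₁).map incl ≫
          (𝒜.fibreBaseChangeIso j xbar ≪≫ 𝒜.fibreCongrPtIso hpt₁ ≪≫ (𝒜.fibreBaseChangeIso xR s₁).symm).inv.hom.hom.hom) ≫ qbar) :
    ∃ m : (Over.pullback s₂).obj 𝒦 ⟶ (Over.pullback s₂).obj 𝒵,
      m ≫ (((Over.pullback s₂).map ζ ≫
          (𝒜.fibreBaseChangeIso j xbar₂ ≪≫ 𝒜.fibreCongrPtIso hpt₂' ≪≫ (𝒜.fibreBaseChangeIso xR₂ s₂).symm).inv.hom.hom.hom) ≫ cbar) =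
        ((Over.pullback s₂).map incl ≫
          (𝒜.fibreBaseChangeIso j xbar ≪≫ 𝒜.fibreCongrPtIso hpt₂ ≪≫ (𝒜.fibreBaseChangeIso xR s₂).symm).inv.hom.hom.hom) ≫ qbar := by
  subst h
  exact h₁

end Transport

section KillEngine

set_option synthInstance.maxHeartbeats 100000

open Literature.AlgebraicGeometry.GroupSchemes (GroupSchemeKernel.ker GroupSchemeKernel.kerι GroupSchemeKernel.kerLift GroupSchemeKernel.kerLift_ι
  GroupSchemeKernel.kerι_comp GroupSchemeKernel.isClosedImmersion_kerι_left_of_isSeparated)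
open Literature.AlgebraicGeometry.GroupSchemes.AffineGroupScheme (quotIncl ptEquiv spI exists_comp_quotIncl_eq_of_le_ker exists_hom_comp_eq_quotIncl_of_forall
  ptEquiv_quotIncl pullback_map_quotIncl_sat_comp_eq_one quotIncl_spI_comp_eq_one_of_pullback_map flat_specOver_quotient_sat_hom algBaseChangeEquiv)

-- the frame of the D-line՚s `Letters` section VERBATIM
variable {F : Type} [Field F] [NumberField F] [IsCMField F] {ι₁ : F →+* ℂ}
    {Jstar : Matrix (Fin 2) (Fin 2) F}
    {K₀ : C5.OpenCompactSubgroup ↥(finAdelic ↥(maximalRealSubfield F) F (IsCMField.complexConj F) 2 Jstar)}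
    {S : RecordSystemGS F Jstar ι₁ K₀} {hU7ₛ : S.HeckeTranslateDefinedOver}
    {hJ : (Jstar.map (IsCMField.complexConj F))ᵀ = Jstar} {hJu : IsUnit Jstar}
    {Fi : Type} [Field Fi] [Algebra F Fi] {Kc : C5.SmallLevel K₀} {G : Type} [Group G]
    {𝓜 : IntegralModel (𝓞 F) F ((thickening F Fi).obj (S.M.obj Kc))}
    {w : HeightOneSpectrum (𝓞 F)} {hw : (IsCMField.complexConj F) • w ≠ w} {h𝓨 : (𝓜.localise w).IsSmoothProper 1}
    {θ : ActionOver (𝓜.localise w).total.hom ((Fi ≃ₐ[F] Fi) × G)}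
    {e : Fi →ₐ[F] AlgebraicClosure (w.adicCompletion F)}

variable (I : RGDInputsAt F ι₁ Jstar K₀ S hU7ₛ hJ hJu Fi Kc G 𝓜 w hw h𝓨 θ e)

/-! ### §1 UPSTAIRS: the image factorisation through `V(eL Lb)` is one through the flat closure `V((eL Lb)^sat)`, in three-piece currency (★ p850899 §1 + (F1)) -/

set_option maxHeartbeats 400000 in
open scoped MonObj CategoryTheory.Obj in
set_option backward.isDefEq.respectTransparency false in
/-- **THE GENERIC IMAGE PREMISS ON THE CLOSURE**: a factorisation of `layerΩ I y ↪ A_y —q→ B` through `V(eL Lb) ↪ layerΩ I y″ ↪ A_{y″} —c→ B` (upstairs, `σΩ`-currency) is one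
of `(layerR I y)_η ↪ (famOf I y)_η ≅ A_y —q→` through `V((eL Lb)^sat)_η ↪ (famOf I y″)_η ≅ A_{y″} —c→` printed through ★ (d5)'s three-piece isomorphisms — ★ p850899
`exists_comp_pullback_map_quotIncl_sat_eq_quotIncl` (`V(eL Lb) → V((eL Lb)^sat)_η`) and the (F1) identifications `hσΩ`, `hσΩ''`. [cite: EGAIV2, Prop. 2.8.5]
[cite: Liu2021, Prop. D.8 (2) p. 135] -/
theorem imgRowHypΩ_of_imgLine (y y'' : AlgPoints (S.M.obj Kc) (AlgebraicClosure (w.adicCompletion F))) (Lb : LineOf I y'')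
    {B : AbelianSchemeOver (Spec (.of (AlgebraicClosure (w.adicCompletion F))))}
    (q : (schΩOf S Kc 𝓜 w e I.univ y).X ⟶ B.X) (c : (schΩOf S Kc 𝓜 w e I.univ y'').X ⟶ B.X)
    (hσΩ : (isoGenericOf I y).inv =
      (I.univ.fibreBaseChangeIso ((𝓜.localise w).genericIso'.inv.left ≫ pullback.fst (𝓜.localise w).total.hom (specGenericPoint (HeightOneSpectrum.valuationSubringAtPrime F w) F))
          (thickeningLift e (S.M.obj Kc) y).left ≪≫
        I.univ.fibreCongrPtIso (left_thickeningLift_comp_genericι_eq S Kc 𝓜 w h𝓨 e y) ≪≫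
        (I.univ.fibreBaseChangeIso (liftOf S Kc 𝓜 w h𝓨 e y).left (sΩ w)).symm).inv.hom.hom.hom)
    (hσΩ'' : (isoGenericOf I y'').inv =
      (I.univ.fibreBaseChangeIso ((𝓜.localise w).genericIso'.inv.left ≫ pullback.fst (𝓜.localise w).total.hom (specGenericPoint (HeightOneSpectrum.valuationSubringAtPrime F w) F))
          (thickeningLift e (S.M.obj Kc) y'').left ≪≫
        I.univ.fibreCongrPtIso (left_thickeningLift_comp_genericι_eq S Kc 𝓜 w h𝓨 e y'') ≪≫
        (I.univ.fibreBaseChangeIso (liftOf S Kc 𝓜 w h𝓨 e y'').left (sΩ w)).symm).inv.hom.hom.hom)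
    (himgΩ : haveI := isMonHom_transR I y; haveI := isMonHom_transR I y''; haveI := isAffine_layerΩ_left I y''
      ∃ m₀ : layerΩ I y ⟶ specOver (AlgebraicClosure (w.adicCompletion F)) (Alg (layerΩ I y'') ⧸ (eLOf I y'' Lb).1),
        m₀ ≫ quotIncl (layerΩ I y'') (eLOf I y'' Lb).1 ≫ (Over.pullback (sΩ w)).map (ιR I y'') ≫ (isoGenericOf I y'').inv ≫ c =
          (Over.pullback (sΩ w)).map (ιR I y) ≫ (isoGenericOf I y).inv ≫ q) :
    haveI := isMonHom_transR I y
    haveI := isMonHom_transR I y''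
    haveI := isAffine_layerR_left I y''
    ∃ m : (Over.pullback (sΩ w)).obj (layerR I y) ⟶
        (Over.pullback (sΩ w)).obj (specOver ↥(closureValuationSubring (w.adicCompletion F)) (Alg (layerR I y'') ⧸ satOf I y'' Lb)),
      m ≫ (((Over.pullback (sΩ w)).map (closureInclOf I y'' Lb) ≫
          (I.univ.fibreBaseChangeIso ((𝓜.localise w).genericIso'.inv.left ≫ pullback.fst (𝓜.localise w).total.hom (specGenericPoint (HeightOneSpectrum.valuationSubringAtPrime F w) F))
              (thickeningLift e (S.M.obj Kc) y'').left ≪≫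
            I.univ.fibreCongrPtIso (left_thickeningLift_comp_genericι_eq S Kc 𝓜 w h𝓨 e y'') ≪≫
            (I.univ.fibreBaseChangeIso (liftOf S Kc 𝓜 w h𝓨 e y'').left (sΩ w)).symm).inv.hom.hom.hom) ≫ c) =
        ((Over.pullback (sΩ w)).map (ιR I y) ≫
          (I.univ.fibreBaseChangeIso ((𝓜.localise w).genericIso'.inv.left ≫ pullback.fst (𝓜.localise w).total.hom (specGenericPoint (HeightOneSpectrum.valuationSubringAtPrime F w) F))
              (thickeningLift e (S.M.obj Kc) y).left ≪≫
            I.univ.fibreCongrPtIso (left_thickeningLift_comp_genericι_eq S Kc 𝓜 w h𝓨 e y) ≪≫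
            (I.univ.fibreBaseChangeIso (liftOf S Kc 𝓜 w h𝓨 e y).left (sΩ w)).symm).inv.hom.hom.hom) ≫ q := by
  haveI := isMonHom_transR I y
  haveI := isMonHom_transR I y''
  haveI := isAffine_layerR_left I y''
  haveI := isAffine_layerΩ_left I y''
  obtain ⟨m₀, hm₀⟩ := himgΩ
  -- `V(eL Lb) → V((eL Lb)^sat)_η` over `layerΩ I y″` (★ p850899 §1)
  have Hb := Literature.AlgebraicGeometry.GroupSchemes.AffineGroupScheme.exists_comp_pullback_map_quotIncl_sat_eq_quotIncl
    (AlgebraicClosure (w.adicCompletion F)) (layerR I y'') (eLOf I y'' Lb).1 (eLOf I y'' Lb).2.1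
  obtain ⟨b, hb⟩ := Hb
  refine ⟨m₀ ≫ b, ?_⟩
  rw [← hσΩ, ← hσΩ'']
  simp only [Functor.map_comp, Category.assoc]
  rw [reassoc_of% hb]
  simpa only [Category.assoc] using hm₀

/-! ### §2 DOWNSTAIRS: a factorisation at `sκ w` through the special fibre of the closure, in `σκ`-currency, gives `himg` on the docks (★ p850899 §1, `εOf`, ★ `AdmIdealTransport`) -/

set_option maxHeartbeats 400000 in
open scoped MonObj CategoryTheory.Obj in
set_option backward.isDefEq.respectTransparency false in
/-- **THE SPECIAL HALF, (a) OUT OF THE CLOSURE**: a factorisation of `(layerR I y)_{sκ} ↪ (famOf I y)_{sκ} —σκ⁻¹→ A_{x̄} —ψ→` through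
`V((eL Lb)^sat)_{sκ} ↪ (famOf I y″)_{sκ} —σκ⁻¹→ A_{x̄″} —cbar→` is one of `layerκ I y` through `V(spIOf I y″ Lb) ↪ layerκ I y″` (★ p850899
`exists_comp_quotIncl_spI_eq_pullback_map_quotIncl_sat`: the special fibre of the closure IS `V(spI)`). [cite: EGAIV2, Prop. 2.8.5] [cite: Tate1997FiniteFlatGroupSchemes, (3.7)] -/
theorem exists_comp_quotIncl_spIOf_of_imgRowκ (y y'' : AlgPoints (S.M.obj Kc) (AlgebraicClosure (w.adicCompletion F))) (Lb : LineOf I y'')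
    {M : SchemeOver (geomResidueField w)}
    (ψ : (sch₀Of 𝓜 w I.univ (red₀Of S Kc 𝓜 w h𝓨 e y)).X ⟶ M) (cbar : (sch₀Of 𝓜 w I.univ (red₀Of S Kc 𝓜 w h𝓨 e y'')).X ⟶ M)
    (h4 : haveI := isMonHom_transR I y; haveI := isMonHom_transR I y''; haveI := isAffine_layerR_left I y''
      ∃ mbar : (Over.pullback (sκ w)).obj (layerR I y) ⟶
          (Over.pullback (sκ w)).obj (specOver ↥(closureValuationSubring (w.adicCompletion F)) (Alg (layerR I y'') ⧸ satOf I y'' Lb)),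
        mbar ≫ (((Over.pullback (sκ w)).map (closureInclOf I y'' Lb) ≫ (isoSpecialOf I y'').inv) ≫ cbar) =
          ((Over.pullback (sκ w)).map (ιR I y) ≫ (isoSpecialOf I y).inv) ≫ ψ) :
    haveI := isMonHom_transR I y
    haveI := isMonHom_transR I y''
    haveI := isAffine_layerκ_left I y''
    ∃ s₀ : layerκ I y ⟶ specOver (geomResidueField w) (Alg (layerκ I y'') ⧸ spIOf I y'' Lb),
      s₀ ≫ quotIncl (layerκ I y'') (spIOf I y'' Lb) ≫ (Over.pullback (sκ w)).map (ιR I y'') ≫ (isoSpecialOf I y'').inv ≫ cbar =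
        (Over.pullback (sκ w)).map (ιR I y) ≫ (isoSpecialOf I y).inv ≫ ψ := by
  letI := (toGeomκ w).toAlgebra
  haveI := isMonHom_transR I y
  haveI := isMonHom_transR I y''
  haveI := isAffine_layerR_left I y''
  haveI := isAffine_layerκ_left I y''
  haveI := isAffine_layerΩ_left I y''
  obtain ⟨mbar, hmbar⟩ := h4
  -- `V(J^sat)_{sκ} → V(spIOf y″ Lb)` over `layerκ I y″` (★ p850899 §1)
  have Hbb := Literature.AlgebraicGeometry.GroupSchemes.AffineGroupScheme.exists_comp_quotIncl_spI_eq_pullback_map_quotIncl_sat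
    (AlgebraicClosure (w.adicCompletion F)) (geomResidueField w) (layerR I y'') (eLOf I y'' Lb).1 (eLOf I y'' Lb).2.1
  obtain ⟨bb, hbb⟩ := Hbb
  have hbb' : bb ≫ quotIncl (layerκ I y'') (spIOf I y'' Lb) = (Over.pullback (sκ w)).map (quotIncl (layerR I y'') (satOf I y'' Lb)) := hbb
  simp only [Functor.map_comp, Category.assoc] at hmbar
  refine ⟨mbar ≫ bb, ?_⟩
  rw [Category.assoc, reassoc_of% hbb', hmbar]

set_option maxHeartbeats 400000 in
open scoped MonObj CategoryTheory.Obj in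
set_option backward.isDefEq.respectTransparency false in
/-- **THE SPECIAL HALF, (b) THE TARGET DOCK**: transport the factorisation through `V(spIOf I y″ Lb) ↪ layerκ I y″ ↪ (famOf I y″)_{sκ} —σκ⁻¹→ A_{x̄″}` to one through
`V(spGeoOf I 𝔡 y″ Lb) ↪ G₀(x̄″) ↪ A_{x̄″}` (★ `AdmIdealTransport.exists_comp_quotIncl_comap_eq` along `ε″`, `spGeoOf = comap_ε spIOf` (§1d), and `ε″ ≫ ι₀G ≫ σκ = (ιR)_{sκ}` (§1b)).
[cite: Tate1997FiniteFlatGroupSchemes, (3.7)] [cite: GortzWedhorn2023, (27.1.1) and §(27.2) (p. 607)] -/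
theorem exists_comp_quotIncl_spGeoOf_of_spIOf [ExpChar (geomResidueField w) I.pChar] (𝔡 : ∀ xbar, DockAt I xbar)
    (y y'' : AlgPoints (S.M.obj Kc) (AlgebraicClosure (w.adicCompletion F))) (Lb : LineOf I y'')
    {M : SchemeOver (geomResidueField w)}
    (ψ : (sch₀Of 𝓜 w I.univ (red₀Of S Kc 𝓜 w h𝓨 e y)).X ⟶ M) (cbar : (sch₀Of 𝓜 w I.univ (red₀Of S Kc 𝓜 w h𝓨 e y'')).X ⟶ M)
    (h5 : haveI := isMonHom_transR I y; haveI := isMonHom_transR I y''; haveI := isAffine_layerκ_left I y''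
      ∃ s₀ : layerκ I y ⟶ specOver (geomResidueField w) (Alg (layerκ I y'') ⧸ spIOf I y'' Lb),
        s₀ ≫ quotIncl (layerκ I y'') (spIOf I y'' Lb) ≫ (Over.pullback (sκ w)).map (ιR I y'') ≫ (isoSpecialOf I y'').inv ≫ cbar =
          (Over.pullback (sκ w)).map (ιR I y) ≫ (isoSpecialOf I y).inv ≫ ψ) :
    haveI := isMonHom_transR I y
    letI := (𝔡 (red₀Of S Kc 𝓜 w h𝓨 e y'')).grp₀
    haveI := (𝔡 (red₀Of S Kc 𝓜 w h𝓨 e y'')).aff₀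
    ∃ s₁ : layerκ I y ⟶ specOver (geomResidueField w) (Alg (𝔡 (red₀Of S Kc 𝓜 w h𝓨 e y'')).G₀ ⧸ (spGeoOf I 𝔡 y'' Lb).1),
      s₁ ≫ quotIncl (𝔡 (red₀Of S Kc 𝓜 w h𝓨 e y'')).G₀ (spGeoOf I 𝔡 y'' Lb).1 ≫ (𝔡 (red₀Of S Kc 𝓜 w h𝓨 e y'')).ι₀G ≫ cbar =
        (Over.pullback (sκ w)).map (ιR I y) ≫ (isoSpecialOf I y).inv ≫ ψ := by
  letI := (𝔡 (red₀Of S Kc 𝓜 w h𝓨 e y'')).grp₀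
  haveI := (𝔡 (red₀Of S Kc 𝓜 w h𝓨 e y'')).aff₀
  haveI := isMonHom_transR I y
  haveI := isMonHom_transR I y''
  haveI := isAffine_layerκ_left I y''
  obtain ⟨s₀, hs₀⟩ := h5
  -- `V(spIOf y″ Lb) → V(spGeoOf y″ Lb)` along the dock identification `ε″`
  have Htr := Literature.AlgebraicGeometry.GroupSchemes.AdmIdealTransport.exists_comp_quotIncl_comap_eq (εOf I 𝔡 y'').hom (spIOf I y'' Lb)
  obtain ⟨tr, htr⟩ := Htr
  have htr' : tr ≫ quotIncl (𝔡 (red₀Of S Kc 𝓜 w h𝓨 e y'')).G₀ (spGeoOf I 𝔡 y'' Lb).1 = quotIncl (layerκ I y'') (spIOf I y'' Lb) ≫ (εOf I 𝔡 y'').hom := htr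
  have eε'' : (Over.pullback (sκ w)).map (ιR I y'') ≫ (isoSpecialOf I y'').inv = (εOf I 𝔡 y'').hom ≫ (𝔡 (red₀Of S Kc 𝓜 w h𝓨 e y'')).ι₀G := by
    rw [← εOf_hom_comp_ι₀G_comp_isoSpecialOf_hom I 𝔡 y'']
    simp only [Category.assoc, Iso.hom_inv_id, Category.comp_id]
  refine ⟨s₀ ≫ tr, ?_⟩
  rw [Category.assoc, reassoc_of% htr', ← reassoc_of% eε'', hs₀]

set_option maxHeartbeats 400000 in
open scoped MonObj CategoryTheory.Obj in
set_option backward.isDefEq.respectTransparency false in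
/-- **THE SPECIAL HALF, (c) THE SOURCE DOCK**: read the source `layerκ I y ↪ (famOf I y)_{sκ} —σκ⁻¹→ A_{x̄}` as `G₀(x̄) ↪ A_{x̄}` through `ε` (§1b), pointwise in `T`:
the `himg` text. [cite: Tate1997FiniteFlatGroupSchemes, (3.7)] [cite: Liu2021, Prop. D.8 (2) p. 135, p. 137] -/
theorem himg_of_imgRowκ [ExpChar (geomResidueField w) I.pChar] (𝔡 : ∀ xbar, DockAt I xbar)
    (y y'' : AlgPoints (S.M.obj Kc) (AlgebraicClosure (w.adicCompletion F))) (Lb : LineOf I y'')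
    {M : SchemeOver (geomResidueField w)}
    (ψ : (sch₀Of 𝓜 w I.univ (red₀Of S Kc 𝓜 w h𝓨 e y)).X ⟶ M) (cbar : (sch₀Of 𝓜 w I.univ (red₀Of S Kc 𝓜 w h𝓨 e y'')).X ⟶ M)
    (h6 : haveI := isMonHom_transR I y; letI := (𝔡 (red₀Of S Kc 𝓜 w h𝓨 e y'')).grp₀; haveI := (𝔡 (red₀Of S Kc 𝓜 w h𝓨 e y'')).aff₀
      ∃ s₁ : layerκ I y ⟶ specOver (geomResidueField w) (Alg (𝔡 (red₀Of S Kc 𝓜 w h𝓨 e y'')).G₀ ⧸ (spGeoOf I 𝔡 y'' Lb).1),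
        s₁ ≫ quotIncl (𝔡 (red₀Of S Kc 𝓜 w h𝓨 e y'')).G₀ (spGeoOf I 𝔡 y'' Lb).1 ≫ (𝔡 (red₀Of S Kc 𝓜 w h𝓨 e y'')).ι₀G ≫ cbar =
          (Over.pullback (sκ w)).map (ιR I y) ≫ (isoSpecialOf I y).inv ≫ ψ)
    ⦃T : SchemeOver (geomResidueField w)⦄ (t : T ⟶ (𝔡 (red₀Of S Kc 𝓜 w h𝓨 e y)).G₀) :
    letI := (𝔡 (red₀Of S Kc 𝓜 w h𝓨 e y)).grp₀
    haveI := (𝔡 (red₀Of S Kc 𝓜 w h𝓨 e y)).aff₀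
    letI := (𝔡 (red₀Of S Kc 𝓜 w h𝓨 e y'')).grp₀
    haveI := (𝔡 (red₀Of S Kc 𝓜 w h𝓨 e y'')).aff₀
    ∃ s : T ⟶ specOver (geomResidueField w) (Alg (𝔡 (red₀Of S Kc 𝓜 w h𝓨 e y'')).G₀ ⧸ (spGeoOf I 𝔡 y'' Lb).1),
      s ≫ quotIncl (𝔡 (red₀Of S Kc 𝓜 w h𝓨 e y'')).G₀ (spGeoOf I 𝔡 y'' Lb).1 ≫ (𝔡 (red₀Of S Kc 𝓜 w h𝓨 e y'')).ι₀G ≫ cbar =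
        t ≫ (𝔡 (red₀Of S Kc 𝓜 w h𝓨 e y)).ι₀G ≫ ψ := by
  letI := (𝔡 (red₀Of S Kc 𝓜 w h𝓨 e y)).grp₀
  haveI := (𝔡 (red₀Of S Kc 𝓜 w h𝓨 e y)).aff₀
  letI := (𝔡 (red₀Of S Kc 𝓜 w h𝓨 e y'')).grp₀
  haveI := (𝔡 (red₀Of S Kc 𝓜 w h𝓨 e y'')).aff₀
  haveI := isMonHom_transR I y
  obtain ⟨s₁, hs₁⟩ := h6
  have eε : (Over.pullback (sκ w)).map (ιR I y) ≫ (isoSpecialOf I y).inv = (εOf I 𝔡 y).hom ≫ (𝔡 (red₀Of S Kc 𝓜 w h𝓨 e y)).ι₀G := by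
    rw [← εOf_hom_comp_ι₀G_comp_isoSpecialOf_hom I 𝔡 y]
    simp only [Category.assoc, Iso.hom_inv_id, Category.comp_id]
  refine ⟨t ≫ (εOf I 𝔡 y).inv ≫ s₁, ?_⟩
  simp only [Category.assoc]
  rw [hs₁, reassoc_of% eε, Iso.inv_hom_id_assoc]

end KillEngine

end Summit.HodgeConjecture.HodgeConjecture.Cruxes.HLiu418.F0P6aLineSpecialisation

end
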